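import Summits.BirchSwinnertonDyer.BirchSwinnertonDyer.Theorems.AdditiveKolyvaginRoadToricFrobenius
import Summits.BirchSwinnertonDyer.BirchSwinnertonDyer.Theorems.KolyvaginRoadThreeMethod2LocalInputsLineTrans
import Literature.NumberTheory.EllipticCurves.ModPIrreducibleCongruenceTransferProofs
import Literature.NumberTheory.EllipticCurves.SupersingularDensitySerreTraceProofs
import HarnessLib

/-!
# Route `AdditiveKolyvaginRoad`, crux `KolyvaginPrimitiveAdditive` (item stmt-BirchSwinnertonDyer-20132):
# stub A1 `stub_rankLoweringAdditive` — the LOCAL PICTURE at a Bertolini–Darmon admissible prime for a GENERAL prime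
# `p`: the inputs (Line) and (Trans) of `selQP_rankLowering_of_localGlobal` DISCHARGED IN THE KERNEL
# (cell `pub/bsd-wall`, lead prover `bsd-wall-akr-p1` g2; `--supports stmt-BirchSwinnertonDyer-20132`, helper;
# p-generic port of zhang3-p1's `Theorems/KolyvaginRoadThreeMethod2LocalInputsLineTrans.lean` with
# unipotent-admissible ↦ BD-admissible (`ρ̄(Frob_q) ∼ diag(ε, εq)` instead of `±(1 + N')`), ordinary ↦ TORIC)

WHY THIS FILE. `Theorems/AdditiveKolyvaginRoadRankLoweringReduction.lean` (akr-p1 g0, p511644) reduced the registered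
stub A1 of crux 20132 — (A1) rank lowering for the p-generic canonical level-raised Selmer spaces `SelQP` — to five
local–global inputs at ONE Bertolini–Darmon `1`-admissible prime `q` (`q ∤ pN`, `q` inert in `K`, `p ∤ q² − 1`,
`p ∣ q + 1 ∓ a_q`): (Cheb), (Equiv), (Line), (Trans), (Iso). This file PROVES (Line) and (Trans) in the binder shapes
of that reduction VERBATIM — (Line) for every number field `K` with `[K : ℚ] = 2`, (Trans) for every number field:

* §1 the residual Frobenius at a BD-admissible prime: for an arithmetic Frobenius `h ∈ Γ_ℚ` above `q`, on the
  `𝔽_p`-plane `E[p]` one has `det ρ̄(h) = q` (tree `det_galoisRepTorsion_frobenius_eq`, DDT Prop. 2.8(a)) and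
  `tr ρ̄(h) = a_q` (tree `trace_galoisRepTorsion_frobenius_eq`, Serre (238)); so `ρ̄(h)² ≠ 1` (`q² ≢ 1`) and, by
  Cayley–Hamilton with `a_q ≡ ε(q + 1)`, `(ρ̄(h) − ε)(ρ̄(h) − εq) = 0` with `ρ̄(h) ≠ εq` — `ρ̄(h)` has the eigenvalue
  `ε = ±1` (W. Zhang 2014 Notations (xiv): `ρ̄(Frob_q) ∼ diag(ε, εq)`); at the place `v ∣ q` of a quadratic `K` the
  Frobenius `F` of the local picture (`res F = h²`, `f(v|q) = 2`) is `≠ 1` on `E(K̄)[p]` and has a non-zero fixed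
  point.
* §2 (Line) VERBATIM — `H¹_f(K_v, E[p]) = H¹_ur ≅ E[p]/(F − 1)E[p]` is cyclic (zhang3-p1's structural
  `LocalFrob.exists_torsionLocMap_selmerLocalKer_eq_zsmul` + the cyclic cokernel of `F − 1 ≠ 0` from the sibling
  `AdditiveKolyvaginRoadToricFrobenius`); (Trans) VERBATIM in its TORIC form — from the sibling's structural
  `ToricFrob.selmerLocalKer_inf_toricLocalKer_le_torsionLocalKer`.

HONEST FRAMING: theorems only; no definition, no named fact, no `sorry`; (Cheb), (Equiv), (Iso) and the other stubs
untouched; nothing about Heegner points or the crux is asserted; nothing is booked.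

References: [cite: BertoliniDarmon2005, p. 18 (admissible primes), §2.2 Lemma 2.6] [cite: WZhang2014, Notations (xiv),
§4.1, Prop. 5.4] [cite: DarmonDiamondTaylor1995, Prop. 2.8 (a)] [cite: Serre1981, §8.1 eq. (238)]
[cite: NeukirchANT1999, Ch. I §9 (9.4)–(9.5)].
-/

-- single-conjunct summit: `Summit.BirchSwinnertonDyer.BirchSwinnertonDyer.…` repeats the name by design
set_option linter.dupNamespace false

noncomputable section

open scoped Classical Pointwise
open Polynomial

universe u

namespace Summit.BirchSwinnertonDyer.BirchSwinnertonDyer.Theorems.AdditiveKoly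

open WeierstrassCurve NumberField IsDedekindDomain Field Rat.HeightOneSpectrum
open Literature.NumberTheory.EllipticCurves Literature.NumberTheory.GaloisRepresentations Module
open Summit.BirchSwinnertonDyer.Rank1Residual.X11b.Three.Koly.Method2

/-! ## §1 The Frobenius at the place above a Bertolini–Darmon admissible prime of a quadratic field -/

section Admissible

/-- On a `2`-dimensional space the characteristic polynomial of an endomorphism `f` is `X² − tr(f) X + det(f)`
(Mathlib `Matrix.charpoly_fin_two` in a basis; a copy of koly g13's private lemma). [folklore] -/
private theorem charpoly_eq_of_finrank_eq_two {k : Type*} [Field k] {V : Type*} [AddCommGroup V] [Module k V]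
    [FiniteDimensional k V] (h2 : Module.finrank k V = 2) (f : Module.End k V) :
    f.charpoly = X ^ 2 - C (LinearMap.trace k V f) * X + C (LinearMap.det f) := by
  let b := Module.finBasisOfFinrankEq k V h2
  rw [← LinearMap.charpoly_toMatrix f b, Matrix.charpoly_fin_two,
    ← LinearMap.trace_eq_matrix_trace k b f, LinearMap.det_toMatrix b f]

/-- Cayley–Hamilton in dimension `2`, pointwise: `f (f x) = tr(f) • f x - det(f) • x`. [folklore] -/
private theorem apply_apply_eq_of_finrank_eq_two {k : Type*} [Field k] {V : Type*} [AddCommGroup V] [Module k V]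
    [FiniteDimensional k V] (h2 : Module.finrank k V = 2) (f : Module.End k V) (x : V) :
    f (f x) = LinearMap.trace k V f • f x - LinearMap.det f • x := by
  have hCH := LinearMap.aeval_self_charpoly f
  rw [charpoly_eq_of_finrank_eq_two h2, map_add, map_sub, map_mul, aeval_C, aeval_C, map_pow, aeval_X] at hCH
  have h := congrArg (fun g : Module.End k V => g x) hCH
  simp only [LinearMap.add_apply, LinearMap.sub_apply, LinearMap.zero_apply, Module.End.mul_apply,
    pow_two, Module.algebraMap_end_apply] at h
  rw [sub_add_eq_add_sub, sub_eq_zero] at h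
  rw [eq_sub_iff_add_eq]
  rw [← h]

variable (W : WeierstrassCurve ℚ) [W.IsElliptic] [W.IsGloballyMinimal]

/-- **The residual Frobenius at a Bertolini–Darmon admissible prime: `ρ̄(Frob_q)² ≠ 1` and `ρ̄(Frob_q)` has the
eigenvalue `±1`.** Let `p` be a prime and `q` a BD `1`-admissible prime for `(E, K, p)` (`q ∤ pN_E`, `p ∤ q² − 1`,
`p ∣ q + 1 − a_q` or `p ∣ q + 1 + a_q`); let `h ∈ Γ_ℚ` be an arithmetic Frobenius at a prime of `\bar ℤ` above `q`.
Then on `E(ℚ̄)[p]`: (i) `h²P ≠ P` for some `P` (`det ρ̄(h)² = q² ≠ 1`); (ii) `hP = εP` with `ε = ±1` for some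
`P ≠ 0` (`X² − a_q X + q` has the root `ε` mod `p`; Cayley–Hamilton: `(ρ̄(h) − ε)(ρ̄(h) − εq) = 0` and
`ρ̄(h) ≠ εq` as `q ≢ 1`). [cite: BertoliniDarmon2005, p. 18] [cite: WZhang2014, Notations (xiv)]
[cite: DarmonDiamondTaylor1995, Prop. 2.8 (a)] [cite: Serre1981, §8.1 eq. (238)] -/
theorem frob_sq_ne_one_and_exists_fixed_of_isAdmissiblePrime {p : ℕ} [Fact p.Prime]
    {K : Type} [Field K] [NumberField K] {q : ℕ}
    (hq : BertoliniDarmon2005.IsAdmissiblePrime (W.conductorNorm ℤ) K (fun ℓ ↦ W.frobeniusTrace ℓ) p 1 q)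
    {w : HeightOneSpectrum (𝓞 ℚ)} (hqw : (q : 𝓞 ℚ) ∈ w.asIdeal)
    {𝔓 : Ideal (absIntegers (𝓞 ℚ) ℚ)} (h𝔓 : 𝔓 ∈ w.primesAbove)
    {h : absoluteGaloisGroup ℚ} (hh : IsArithFrobAt (𝓞 ℚ) h 𝔓) :
    (∃ P : geomTorsion W (p : ℤ), h • h • P ≠ P) ∧
      ∃ (ε : ℤ) (P : geomTorsion W (p : ℤ)), (ε = 1 ∨ ε = -1) ∧ P ≠ 0 ∧ h • P = ε • P := by
  have hp : p.Prime := Fact.out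
  obtain ⟨hqprime, hqpN, -, hsq, hcong⟩ := hq
  haveI : Fact q.Prime := ⟨hqprime⟩
  have hqN : ¬ q ∣ W.conductorNorm ℤ := fun h' ↦ hqpN (Dvd.dvd.mul_left h' p)
  have hqp : q ≠ p := by
    rintro rfl
    exact hqpN (dvd_mul_right q _)
  -- good reduction at `q`, `primesEquiv w = q`
  have hvq : (primesEquiv w : ℕ) = q := primesEquiv_eq_of_natCast_mem hqprime hqw
  have hgood : W.HasGoodReductionAtPrime q :=
    (hasGoodReductionAtPrime_primesEquiv_iff_holds W w q hvq).mpr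
      (LocalFrob.hasGoodReductionAt_rat_of_not_dvd_conductorNorm W hqprime hqN w hqw)
  -- the linear map of `h` on the `𝔽_p`-plane `E[p]`
  letI : Module (ZMod p) (geomTorsion W (p : ℤ)) := AddSubgroup.torsionBy.zmodModule
  set f := (galoisRepTorsion W p h).toAdd.toAddMonoidHom.toZModLinearMap p with hfdef
  have hf : ∀ Q : geomTorsion W (p : ℤ), f Q = h • Q := fun Q => rfl
  have htr : LinearMap.trace (ZMod p) _ f = (W.frobeniusTrace q : ZMod p) :=
    W.trace_galoisRepTorsion_frobenius_eq p hqp hgood hvq h𝔓 hh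
  have hdet : LinearMap.det f = (q : ZMod p) := W.det_galoisRepTorsion_frobenius_eq p hqp hgood hvq h𝔓 hh
  have h2 : Module.finrank (ZMod p) (geomTorsion W (p : ℤ)) = 2 :=
    Literature.RepresentationTheory.FiniteGroups.Representation.finrank_eq_two_of_natCard_eq_sq
      (card_torsionPoints_eq_sq_holds W (AlgebraicClosure ℚ) (n := p) (by exact_mod_cast hp.ne_zero))
  haveI : FiniteDimensional (ZMod p) (geomTorsion W (p : ℤ)) := Module.finite_of_finrank_eq_succ h2
  -- `q² ≠ 1` in `𝔽_p`
  have hq2 : (q : ZMod p) * (q : ZMod p) ≠ 1 := by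
    intro h1
    apply hsq
    have h1' : (((q : ℤ) ^ 2 - 1 : ℤ) : ZMod p) = 0 := by push_cast; rw [pow_two, h1, sub_self]
    exact (ZMod.intCast_zmod_eq_zero_iff_dvd _ p).mp h1'
  constructor
  · -- (i) `h² ≠ 1`: `det f² = q² ≠ 1`
    by_contra hall
    push Not at hall
    have hff : f * f = 1 := by
      refine LinearMap.ext fun Q ↦ ?_
      rw [Module.End.mul_apply, hf, hf, hall Q, Module.End.one_apply]
    have := congrArg LinearMap.det hff
    rw [map_mul, hdet, map_one] at this
    exact hq2 this
  · -- (ii) the eigenvalue `ε = ±1`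
    -- the sign from the admissibility congruence: `a_q = ε (q + 1)` in `𝔽_p`
    obtain ⟨ε, hε, haε⟩ : ∃ ε : ℤ, (ε = 1 ∨ ε = -1) ∧
        (W.frobeniusTrace q : ZMod p) = (ε : ZMod p) * ((q : ZMod p) + 1) := by
      rcases hcong with hc | hc
      · refine ⟨1, Or.inl rfl, ?_⟩
        rw [pow_one] at hc
        have h0 : (((q : ℤ) + 1 - W.frobeniusTrace q : ℤ) : ZMod p) = 0 :=
          (ZMod.intCast_zmod_eq_zero_iff_dvd _ p).mpr hc
        push_cast at h0
        rw [Int.cast_one, one_mul]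
        linear_combination -h0
      · refine ⟨-1, Or.inr rfl, ?_⟩
        rw [pow_one] at hc
        have h0 : (((q : ℤ) + 1 + W.frobeniusTrace q : ℤ) : ZMod p) = 0 :=
          (ZMod.intCast_zmod_eq_zero_iff_dvd _ p).mpr hc
        push_cast at h0
        rw [Int.cast_neg, Int.cast_one]
        linear_combination h0
    have hεε : (ε : ZMod p) * (ε : ZMod p) = 1 := by
      rcases hε with rfl | rfl <;> push_cast <;> ring
    -- Cayley–Hamilton: `(f − ε)((f − εq) Q) = 0`
    have hCH : ∀ Q, f (f Q) = ((ε : ZMod p) * ((q : ZMod p) + 1)) • f Q - (q : ZMod p) • Q := fun Q ↦ by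
      rw [apply_apply_eq_of_finrank_eq_two h2 f Q, htr, hdet, haε]
    have hfactor : ∀ Q, f (f Q - ((ε : ZMod p) * (q : ZMod p)) • Q) =
        (ε : ZMod p) • (f Q - ((ε : ZMod p) * (q : ZMod p)) • Q) := fun Q ↦ by
      have : (ε : ZMod p) * ((ε : ZMod p) * (q : ZMod p)) = (q : ZMod p) := by
        rw [← mul_assoc, hεε, one_mul]
      rw [map_sub, map_smul, hCH, smul_sub, smul_smul, this]
      module
    -- `f ≠ εq`: otherwise `tr f = 2εq = ε(q + 1)`, i.e. `q = 1`
    have hne : ∃ Q, f Q - ((ε : ZMod p) * (q : ZMod p)) • Q ≠ 0 := by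
      by_contra hall
      push Not at hall
      have hfeq : f = ((ε : ZMod p) * (q : ZMod p)) • LinearMap.id := by
        refine LinearMap.ext fun Q ↦ ?_
        rw [LinearMap.smul_apply, LinearMap.id_apply, ← sub_eq_zero]
        exact hall Q
      have htr' := htr
      rw [hfeq, map_smul, LinearMap.trace_id, h2, haε, smul_eq_mul] at htr'
      -- `εq · 2 = ε(q + 1)` ⟹ `q = 1` ⟹ `q² = 1`
      have hq1 : (q : ZMod p) = 1 := by
        have h3 : (ε : ZMod p) * ((q : ZMod p) - 1) = 0 := by
          push_cast at htr'
          linear_combination htr'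
        rcases mul_eq_zero.mp h3 with h4 | h4
        · rw [h4, zero_mul] at hεε; exact absurd hεε zero_ne_one
        · exact sub_eq_zero.mp h4
      exact hq2 (by rw [hq1, one_mul])
    obtain ⟨Q, hQ⟩ := hne
    refine ⟨ε, f Q - ((ε : ZMod p) * (q : ZMod p)) • Q, hε, hQ, ?_⟩
    rw [← hf, hfactor, Int.cast_smul_eq_zsmul]

variable (K : Type) [Field K] [NumberField K]

/-- The place of a quadratic field above a BD-admissible prime is a place of good reduction of `E/K`, not above `p`.
[folklore] -/
theorem hasGoodReductionAt_of_isAdmissiblePrime {p : ℕ} [Fact p.Prime] {q : ℕ}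
    (hq : BertoliniDarmon2005.IsAdmissiblePrime (W.conductorNorm ℤ) K (fun ℓ ↦ W.frobeniusTrace ℓ) p 1 q)
    (v : HeightOneSpectrum (𝓞 K)) (hqv : (q : 𝓞 K) ∈ v.asIdeal) :
    (W.baseChange K).HasGoodReductionAt v ∧ (((p : ℤ) : 𝓞 K) ∉ v.asIdeal) := by
  have hp : p.Prime := Fact.out
  obtain ⟨hqprime, hqpN, -, -, -⟩ := hq
  have hqN : ¬ q ∣ W.conductorNorm ℤ := fun h' ↦ hqpN (Dvd.dvd.mul_left h' p)
  have hqp : q ≠ p := by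
    rintro rfl
    exact hqpN (dvd_mul_right q _)
  have hqw : (q : 𝓞 ℚ) ∈ (v.under (𝓞 ℚ)).asIdeal := by
    change (q : 𝓞 ℚ) ∈ v.asIdeal.under (𝓞 ℚ)
    rw [Ideal.under_def, Ideal.mem_comap, map_natCast]; exact hqv
  haveI : v.asIdeal.LiesOver (v.under (𝓞 ℚ)).asIdeal := ⟨rfl⟩
  refine ⟨hasGoodReductionAt_baseChange_of_hasGoodReductionAt_rat W (v.under (𝓞 ℚ)) v
      (LocalFrob.hasGoodReductionAt_rat_of_not_dvd_conductorNorm W hqprime hqN _ hqw), ?_⟩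
  rw [Int.cast_natCast]
  exact not_mem_asIdeal_of_coprime K ((Nat.coprime_primes hqprime hp).mpr hqp) v hqv

/-- **The Frobenius of the local picture at the place above a BD-admissible prime of a quadratic field, and its
structure on `E(K̄)[p]`.** Let `[K : ℚ] = 2`, `q` BD `1`-admissible for `(E, K, p)`, `v ∣ q` the (unique, `q` inert)
place of `K`, `𝔐` a prime of `\bar 𝓞_v` above `𝓂_v` and `𝔓 = 𝔓_{ι₀,𝔐}`. Then there is an arithmetic Frobenius
`F ∈ Γ_K` at `𝔓` with (i) `F ≠ 1` on `E(K̄)[p]` and (ii) a non-zero `F`-fixed point. Construction: an arithmetic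
Frobenius `h ∈ Γ_ℚ` at `𝔓 ∩ \bar ℤ` (tree `exists_isArithFrobAt_of_mem_primesAbove_holds`); `h²` is a restriction
`res F` (`[K:ℚ] = 2`, zhang3-p1's `sq_mem_range_absGaloisRestrict`) and `F` is a Frobenius at `𝔓` because
`f(v|q) = 2` (`inertiaDeg_eq_two_of_isPrime_span`); `F` acts on `E(K̄)[p] ≃ E(ℚ̄)[p]` as `h²`, and
`frob_sq_ne_one_and_exists_fixed_of_isAdmissiblePrime` applies.
[cite: NeukirchANT1999, Ch. I §9 (9.4)–(9.5)] [cite: BertoliniDarmon2005, p. 18] [cite: WZhang2014, Notations (xiv)] -/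
theorem exists_frob_of_isAdmissiblePrime (hK2 : Module.finrank ℚ K = 2) {p : ℕ} [Fact p.Prime] {q : ℕ}
    (hq : BertoliniDarmon2005.IsAdmissiblePrime (W.conductorNorm ℤ) K (fun ℓ ↦ W.frobeniusTrace ℓ) p 1 q)
    (v : HeightOneSpectrum (𝓞 K)) (hqv : (q : 𝓞 K) ∈ v.asIdeal)
    {𝔐 : Ideal (HeightOneSpectrum.localAbsIntegers v)} (h𝔐 : 𝔐 ∈ v.localPrimesAbove) :
    ∃ F : absoluteGaloisGroup K,
      IsArithFrobAt (𝓞 K) F (v.primeBelow (closureEmb (K := K) (v.adicCompletion K)) 𝔐) ∧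
      (∃ P : geomTorsion (W.baseChange K) (p : ℤ), F • P ≠ P) ∧
      ∃ P : geomTorsion (W.baseChange K) (p : ℤ), P ≠ 0 ∧ F • P = P := by
  haveI : Algebra.IsQuadraticExtension ℚ K := ⟨hK2⟩
  have hq' := hq
  obtain ⟨hqprime, -, hinert, -, -⟩ := hq'
  set ι₀ := closureEmb (K := K) (v.adicCompletion K) with hι₀
  set 𝔓 := v.primeBelow ι₀ 𝔐 with h𝔓def
  have h𝔓 : 𝔓 ∈ v.primesAbove := HeightOneSpectrum.primeBelow_mem_primesAbove h𝔐
  set w : HeightOneSpectrum (𝓞 ℚ) := v.under (𝓞 ℚ) with hw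
  have hwv : v.asIdeal.under (𝓞 ℚ) = w.asIdeal := rfl
  have hqw : (q : 𝓞 ℚ) ∈ w.asIdeal := by
    rw [← hwv, Ideal.under_def, Ideal.mem_comap, map_natCast]; exact hqv
  set 𝔓' := 𝔓.comap (absIntegersMap ℚ K) with h𝔓'def
  have h𝔓' : 𝔓' ∈ w.primesAbove := comap_absIntegersMap_mem_primesAbove hwv h𝔓
  haveI := h𝔓'.1
  -- an arithmetic Frobenius `h ∈ Γ_ℚ` at `𝔓'`, and its structure on `E(ℚ̄)[p]`
  obtain ⟨h, hh⟩ := HeightOneSpectrum.exists_isArithFrobAt_of_mem_primesAbove_holds h𝔓'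
  obtain ⟨⟨P₁, hP₁⟩, ε, P₂, hε, hP₂0, hP₂⟩ := frob_sq_ne_one_and_exists_fixed_of_isAdmissiblePrime W hq hqw h𝔓' hh
  -- `h² = res F`, `F` a Frobenius at `𝔓`
  obtain ⟨F, hF⟩ := LocalFrob.sq_mem_range_absGaloisRestrict K hK2 h
  have hf2 := LocalFrob.inertiaDeg_eq_two_of_isPrime_span K hK2 hqprime hinert v hqv
  have hFrobF : IsArithFrobAt (𝓞 K) F 𝔓 :=
    isArithFrobAt_of_absGaloisRestrict_eq_pow (F := ℚ) (M := K) hwv h𝔓 hh (by rw [hF, hf2])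
  -- `F` acts on `E(K̄)[p]` as `h²` through `θ : E(ℚ̄)[p] ≃ E(K̄)[p]`
  set θ := RatClosure.torsionEquiv (K := K) W (p : ℤ) with hθ
  have hFθ : ∀ P : geomTorsion W (p : ℤ), F • θ P = θ (h • h • P) := fun P ↦ by
    rw [← RatClosure.torsionEquiv_smul, hF, pow_two, mul_smul]
  refine ⟨F, hFrobF, ⟨θ P₁, fun heq ↦ hP₁ (θ.injective (by rw [← hFθ, heq]))⟩, θ P₂, ?_, ?_⟩
  · intro h0
    exact hP₂0 (θ.injective (by rw [h0, map_zero]))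
  · rw [hFθ, hP₂, smul_comm h ε P₂, hP₂, smul_smul]
    rcases hε with rfl | rfl <;> simp

end Admissible

/-! ## §2 (Line) and (Trans) VERBATIM, at every Bertolini–Darmon admissible prime -/

section Inputs

variable (W : WeierstrassCurve ℚ) [W.IsElliptic] [W.IsGloballyMinimal] (K : Type) [Field K] [NumberField K]
  (p : ℕ) [Fact p.Prime]

/-- **(Line) of `selQP_rankLowering_of_localGlobal`, DISCHARGED for `[K : ℚ] = 2`**: at the place `v ∣ q` of a
Bertolini–Darmon admissible prime `q`, the localisations of the classes of `H¹(K, E[p])` satisfying E's Kummer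
condition at `v` are the integer multiples of ONE class of `H¹(K_v, E[p])` (`H¹_f(K_v, E[p]) = H¹_ur ≅
E[p]/(Frob_v − 1)E[p]` is a line, `Frob_v ≠ 1`: Bertolini–Darmon Lemma 2.6). Kernel proof: zhang3-p1's
`LocalFrob.exists_torsionLocMap_selmerLocalKer_eq_zsmul` + §1 + the sibling's `mem_range_or_generates` ( for `g = F − 1 ≠ 0`).
[cite: BertoliniDarmon2005, §2.2 Lemma 2.6] [cite: WZhang2014, §4.1, Prop. 5.4] -/
theorem localLine_of_admQ (hK2 : Module.finrank ℚ K = 2) :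
    ∀ (q : AdmQ W K p) (v : HeightOneSpectrum (𝓞 K)), ((q : ℕ) : 𝓞 K) ∈ v.asIdeal →
      ∃ ℓ, ∀ y ∈ selmerLocalKer (W.baseChange K) (v.adicCompletion K) ((p ^ 1 : ℕ) : ℤ),
        ∃ a : ℤ, (W.baseChange K).torsionLocMap (v.adicCompletion K) ((p ^ 1 : ℕ) : ℤ) y = a • ℓ := by
  intro q v hqv
  have hp : p.Prime := Fact.out
  obtain ⟨hgood, hpv⟩ := hasGoodReductionAt_of_isAdmissiblePrime W K q.2 v hqv
  obtain ⟨𝔐, h𝔐⟩ := v.localPrimesAbove_nonempty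
  obtain ⟨F, hF, ⟨P₁, hP₁⟩, -⟩ := exists_frob_of_isAdmissiblePrime W K hK2 q.2 v hqv h𝔐
  rw [Nat.pow_one]
  refine LocalFrob.exists_torsionLocMap_selmerLocalKer_eq_zsmul (W.baseChange K) hgood (n := p) hp.ne_zero
    hpv h𝔐 hF ?_
  -- `E(K̄)[p]/(F − 1)` is cyclic: the sibling's `mem_range_or_generates` with `g = F − 1 ≠ 0`
  have hT : Nat.card (geomTorsion (W.baseChange K) (p : ℤ)) = p ^ 2 :=
    card_torsionPoints_eq_sq_holds (W.baseChange K) (AlgebraicClosure K) (n := p) (by exact_mod_cast hp.ne_zero)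
  set g := DistribSMul.toAddMonoidHom (geomTorsion (W.baseChange K) (p : ℤ)) F - AddMonoidHom.id _ with hg
  have hgapply : ∀ x, g x = F • x - x := fun x ↦ rfl
  have hg0 : g ≠ 0 := fun h0 ↦ hP₁ (sub_eq_zero.mp (by rw [← hgapply, h0, AddMonoidHom.zero_apply]))
  intro y
  rcases mem_range_or_generates hp hT g hg0 y with ⟨m, hm⟩ | hgen
  · exact Or.inl ⟨m, by rw [hm, hgapply]⟩
  · exact Or.inr fun z ↦ by
      obtain ⟨a, m, hz⟩ := hgen z
      exact ⟨a, m, by rw [hz, hgapply]⟩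

/-- **(Trans) of `selQP_rankLowering_of_localGlobal` (TORIC form), DISCHARGED for every number field `K`**: at the
place `v ∣ q` of a Bertolini–Darmon admissible prime, a class `z` satisfying the TORIC condition at `v` whose
localisation is a multiple of the localisation of a class `y` satisfying the Kummer condition at `v` has localisation
ZERO (`H¹_f ∩ H¹_tor = 0`: Bertolini–Darmon Lemma 2.6). Kernel proof: `z − a y` has localisation `0`, so `z` is
Kummer at `v` too, and `ToricFrob.selmerLocalKer_inf_toricLocalKer_le_torsionLocalKer`.
[cite: BertoliniDarmon2005, §2.2 Lemma 2.6] [cite: WZhang2014, §4.1, Prop. 5.4] -/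
theorem localTrans_of_admQ :
    ∀ (q : AdmQ W K p) (v : HeightOneSpectrum (𝓞 K)), ((q : ℕ) : 𝓞 K) ∈ v.asIdeal →
      ∀ y z : Vp W K p, y ∈ selmerLocalKer (W.baseChange K) (v.adicCompletion K) ((p ^ 1 : ℕ) : ℤ) →
        z ∈ toricLocalKer (W.baseChange K) (v.adicCompletion K) ((p ^ 1 : ℕ) : ℤ) →
        (∃ a : ℤ, (W.baseChange K).torsionLocMap (v.adicCompletion K) ((p ^ 1 : ℕ) : ℤ) z =
          a • (W.baseChange K).torsionLocMap (v.adicCompletion K) ((p ^ 1 : ℕ) : ℤ) y) →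
        (W.baseChange K).torsionLocMap (v.adicCompletion K) ((p ^ 1 : ℕ) : ℤ) z = 0 := by
  intro q v hqv y z hy hz ⟨a, ha⟩
  have hp : p.Prime := Fact.out
  obtain ⟨hgood, hpv⟩ := hasGoodReductionAt_of_isAdmissiblePrime W K q.2 v hqv
  obtain ⟨𝔐, h𝔐⟩ := v.localPrimesAbove_nonempty
  set loc := (W.baseChange K).torsionLocMap (v.adicCompletion K) ((p ^ 1 : ℕ) : ℤ) with hloc
  -- `z − a y` has localisation zero, hence is Kummer at `v`; so is `z`
  have hza : z - a • y ∈ (W.baseChange K).torsionLocalKer (v.adicCompletion K) ((p ^ 1 : ℕ) : ℤ) := by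
    change loc (z - a • y) = 0
    rw [map_sub, map_zsmul, ha, sub_self]
  have hzsel : z ∈ selmerLocalKer (W.baseChange K) (v.adicCompletion K) ((p ^ 1 : ℕ) : ℤ) := by
    have h1 := (W.baseChange K).torsionLocalKer_le_selmerLocalKer (v.adicCompletion K) _ hza
    have h2 : z = (z - a • y) + a • y := by abel
    rw [h2]
    exact add_mem h1 (AddSubgroup.zsmul_mem _ hy a)
  exact ToricFrob.selmerLocalKer_inf_toricLocalKer_le_torsionLocalKer (W.baseChange K) hgood (n := p ^ 1)
    (pow_ne_zero 1 hp.ne_zero) (by rw [Nat.pow_one]; exact hpv) h𝔐 (AddSubgroup.mem_inf.mpr ⟨hzsel, hz⟩)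

end Inputs

end Summit.BirchSwinnertonDyer.BirchSwinnertonDyer.Theorems.AdditiveKoly

end
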